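import Literature.MathematicalPhysics.QuantumFieldTheory.ConformalBootstrap3D.ZSeriesBlockCoefficients
import Literature.MathematicalPhysics.QuantumFieldTheory.ConformalBootstrap3D.BlockCoefficientUniqueness
import Mathlib.Data.Nat.Choose.Central
import Mathlib.Algebra.BigOperators.NatAntidiagonal
import Mathlib.Algebra.BigOperators.Field
import Mathlib.Tactic.Linarith
import Mathlib.Tactic.Ring
import Mathlib.Tactic.Positivity
import Mathlib.Tactic.FieldSimp
import HarnessLib

/-!
# Existence and identification of 3D conformal-block coefficients: the Hogervorst–Rychkov array solves the monomial Casimir system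

Companion of `BlockCoefficientUniqueness.lean` (the uniqueness half (U) of pub-ising3d REFEREE T1): this
file is the existence / identification half **(E)** for equal external dimensions (`a = b = 0`, the
`σσσσ` and `εεεε` channels). Recall the setting: `IsConformalBlock3DAbove` writes `g = (z z̄)^α K`,
`α = (Δ-ℓ)/2`, `K = Σ k_{mn} z^m z̄^n` symmetric with the Dolan–Osborn boundary condition
`HasLeadingPart ℓ k`, and comparing coefficients in the quadratic Casimir equation gives the linear system
`SatisfiesCoeffCasimir a b Δ ℓ k` (weights `A, B, C, D, E`); Hogervorst–Rychkov instead expand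
`g = Σ_{n,j} A_{n,j} 𝒫_{Δ+n,j}`, `𝒫_{E,j}(s, cos θ) = s^E P_j(cos θ)` in `d = 3` (§3 eq. (3.6),
`ν = 1/2`), with `A_{n,j} = hrCoeff Δ ℓ n j` produced by the recursion (3.9) (`ZSeriesBlockCoefficients`).

DICTIONARY (motivation only — no Legendre polynomial is used below). With `z = s e^{iθ}` one has
`P_j(cos θ) = Σ_{i+r=j} λ_i λ_r e^{i(i-r)θ}`, `λ_i = C(2i,i)/4^i = (1/2)_i/i!` (square the generating
function `(1 - x e^{iθ})^{-1/2} (1 - x e^{-iθ})^{-1/2}`), so `𝒫_{Δ+n,j}/(z z̄)^α = Σ_{i+r=j} λ_i λ_r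
z^{t+i} z̄^{t+r}` with `2t + j = ℓ + n =: N` (the DEGREE): its monomial array is this file's
`legendreArr t j` = `legendreArrDeg N j` = "`e_{N,j}`", supported on the antidiagonal `m + n = N` at the
positions `|m - n| ≤ j`, `m - n ≡ j (mod 2)`. Hence the candidate array

  `hrMonomialCoeff Δ ℓ (m,n) = λ_ℓ⁻¹ Σ_j A_{m+n-ℓ, j} e_{m+n, j}(m,n)`  (`= 0` below degree `ℓ`),

the factor `λ_ℓ⁻¹` converting HR's normalisation (leading term `𝒫_{Δ,ℓ}`) to Dolan–Osborn's `k_{ℓ,0} = 1`.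

What IS proved (all sorry-free; finite casework + `field_simp; ring`, and finite-sum bookkeeping):

* `sum_antidiagonal_legendreLam_mul` — `Σ_{i+r=j} λ_i λ_r = 1` (`P_j(1) = 1`), from
  `λ_{i+1} = λ_i (2i+1)/(2i+2)` (`Nat.succ_mul_centralBinom_succ`);
* **Identity I** `coeffLAB_legendreArrDeg` — on output degree `N + 1` the `A, B` part of the system acts on
  `e_{N,j}` as the SCALAR `casShiftDeg Δ ℓ N j = c_{Δ+N-ℓ, j} - c_{Δ,ℓ}` times the shift
  `zdiff e (P,Q) = e(P-1,Q) - e(P,Q-1)` (multiplication by `z - z̄`): Hogervorst–Rychkov's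
  `𝒟₀ 𝒫_{E,j} = C_{E,j} 𝒫_{E,j}` (§3 eq. (3.7)) in monomial clothing; `2 · casShiftDeg = casimirPivot3D`
  (`two_mul_casShiftDeg`; the `1/2` is the normalisation `casimirEigenvalue3D = C/2` of `CasimirEq3D`);
* **Identity II** `coeffLCDE_legendreArrDeg` — on output degree `N + 2` the `C, D, E` part (at `a = b = 0`)
  maps `e_{N,j}` to `-(γ⁺_{E,j}/2) zdiff e_{N+1,j+1} - (γ⁻_{E,j}/2) zdiff e_{N+1,j-1}`, `E = Δ + N - ℓ`,
  `γ± = hrGammaPlus/hrGammaMinus`: HR's `𝒟₁ 𝒫_{E,j} = -γ⁺ 𝒫_{E+1,j+1} - γ⁻ 𝒫_{E+1,j-1}` (§3 eq. (3.8))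
  at `ν = 1/2` (seven positional cases along the antidiagonal; `γ⁻_{E,0} = 0` covers `j = 0`);
* `hrMonomialCoeff_symm`, `hrMonomialCoeff_hasLeadingPart`, `hrMonomialCoeff_nonneg` (above the
  unitarity bound, from `hrCoeff_nonneg` and `λ_i > 0`), `diagCoeff_hrMonomialCoeff` —
  `d_{ℓ+n} := Σ_{m+m'=ℓ+n} k_{mm'} = hrLevelSum Δ ℓ n / λ_ℓ` (uses `P_j(1) = 1` and `hrCoeff_support`);
* **(E)** `hrMonomialCoeff_satisfies` — for EVERY `Δ > unitarityBound3D ℓ` (accidental degeneracies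
  included: there it is one solution among several) `SatisfiesCoeffCasimir 0 0 Δ ℓ (hrMonomialCoeff Δ ℓ)`:
  Identities I and II reduce each equation to `Σ_j [pivot·A_{n+1,j} - γ⁺A_{n,j-1} - γ⁻A_{n,j+1}]·(zdiff e_{N,j}) = 0`,
  and the bracket vanishes for ALL `j` (`hrCoeff_succ_rec_all`: on the descendant range the pivot is
  positive, `casimirPivot3D_pos`, and the recursion (3.9) applies; off it a child and both its parents
  vanish by `hrCoeff_support`);
* **identification** `SatisfiesCoeffCasimir.eq_hrMonomialCoeff` — with (U): strictly above the unitarity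
  bound and off `accidentalDegeneracy3D Δ ℓ`, THE symmetric solution with `HasLeadingPart ℓ` of the
  `a = b = 0` system is `hrMonomialCoeff Δ ℓ`; corollaries `.nonneg` (every `k_{mn} ≥ 0`),
  `.diagCoeff_eq` (`d_{ℓ+n} = hrLevelSum Δ ℓ n / λ_ℓ`), `.diagCoeff_nonneg`. So on the diagonal
  `g(x,x) = x^{2α} Σ_N d_N x^N = Σ_n (hrLevelSum Δ ℓ n / λ_ℓ) x^{Δ+n}` coefficientwise — exactly the
  non-negative-coefficient input format `Σ a_n y^{Δ+n}` of `DiagonalRatioLemma` / `DiagonalSeriesEnclosure`.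

What is NOT here: (α) the analytic extraction `IsConformalBlock3DAbove … g ⇒ SatisfiesCoeffCasimir` for
its coefficient array and the resummation of `g(x,x)` (termwise differentiation of the double power series
on the open square + identity theorem) — REFEREE T1 (α), open; unequal external dimensions
`(a,b) ≠ (0,0)` (the `σε` channel: HR's (3.9) is the equal-dimension recursion; uniqueness (U) does hold
for all `(a,b)`); any numerical value of a block; convergence (handled downstream from ratio bounds on
`hrLevelSum`, `DiagonalRatioLemma`). The exact-arithmetic prototype of everything in this file is
pub-ising3d `code/monomial_recursion_check.py` / `code/basis_identity_check.py` (0 failures).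

Sources: M. Hogervorst, S. Rychkov, Phys. Rev. D 87 (2013) 106004 [arXiv:1303.1111], §3 eqs. (3.4)–(3.9)
(the basis `𝒫_{E,j}`, `𝒟 = 𝒟₀ + 𝒟₁`, `γ±`, the recursion and its positivity remark); F. A. Dolan,
H. Osborn, arXiv:1108.6194 (2011), §2 eqs. (2.9)–(2.12) (the Casimir equation and boundary condition);
Mathlib: `Nat.centralBinom`, `Nat.succ_mul_centralBinom_succ`, `Finset.antidiagonal`. No conformal-block
or Legendre-addition material exists in Mathlib; the two identities are proved from scratch.
-/

namespace Literature.MathematicalPhysics.QuantumFieldTheory.ConformalBootstrap3D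

open Finset

/-- `λ_i = C(2i,i)/4^i = (1/2)_i / i!`. [folklore] -/
noncomputable def legendreLam (i : ℕ) : ℝ :=
  (Nat.centralBinom i : ℝ) / 4 ^ i

/-- `λ_0 = 1`. [folklore] -/
@[simp] theorem legendreLam_zero : legendreLam 0 = 1 := by
  simp [legendreLam]

/-- `λ_i > 0`. [folklore] -/
theorem legendreLam_pos (i : ℕ) : 0 < legendreLam i := by
  unfold legendreLam
  have : (0 : ℝ) < (Nat.centralBinom i : ℝ) := by exact_mod_cast Nat.centralBinom_pos i
  positivity

/-- `λ_i ≠ 0`. [folklore] -/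
theorem legendreLam_ne_zero (i : ℕ) : legendreLam i ≠ 0 := (legendreLam_pos i).ne'

/-- The recurrence `(2i+2) λ_{i+1} = (2i+1) λ_i`. [folklore] -/
theorem legendreLam_succ_mul (i : ℕ) :
    (2 * (i : ℝ) + 2) * legendreLam (i + 1) = (2 * (i : ℝ) + 1) * legendreLam i := by
  unfold legendreLam
  have h := Nat.succ_mul_centralBinom_succ i
  have h' : ((i : ℝ) + 1) * (Nat.centralBinom (i + 1) : ℝ) =
      2 * (2 * (i : ℝ) + 1) * (Nat.centralBinom i : ℝ) := by exact_mod_cast h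
  have h4 : (4 : ℝ) ^ i ≠ 0 := pow_ne_zero _ (by norm_num)
  calc (2 * (i : ℝ) + 2) * ((Nat.centralBinom (i + 1) : ℝ) / 4 ^ (i + 1))
      = 2 * (((i : ℝ) + 1) * (Nat.centralBinom (i + 1) : ℝ)) / 4 ^ (i + 1) := by ring
    _ = 2 * (2 * (2 * (i : ℝ) + 1) * (Nat.centralBinom i : ℝ)) / 4 ^ (i + 1) := by rw [h']
    _ = (2 * (i : ℝ) + 1) * ((Nat.centralBinom i : ℝ) / 4 ^ i) := by
        rw [pow_succ]
        field_simp
        ring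

/-- The recurrence solved: `λ_{i+1} = λ_i (2i+1)/(2i+2)`. [folklore] -/
theorem legendreLam_succ (i : ℕ) :
    legendreLam (i + 1) = legendreLam i * (2 * (i : ℝ) + 1) / (2 * (i : ℝ) + 2) := by
  have h := legendreLam_succ_mul i
  have h2 : (2 * (i : ℝ) + 2) ≠ 0 := by positivity
  field_simp
  linear_combination h

/-- `λ_1 = 1/2`. [folklore] -/
theorem legendreLam_one : legendreLam 1 = 1 / 2 := by
  have h := legendreLam_succ 0
  rw [zero_add, legendreLam_zero] at h
  rw [h]
  norm_num

/-- `Σ_{i+r=j} λ_i λ_r = 1` (`P_j(1) = 1`; coefficientwise `((1-x)^{-1/2})² = (1-x)^{-1}`). [folklore] -/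
theorem sum_antidiagonal_legendreLam_mul (j : ℕ) :
    ∑ p ∈ antidiagonal j, legendreLam p.1 * legendreLam p.2 = 1 := by
  induction j with
  | zero => simp
  | succ j ih =>
    have hj : ((j : ℝ) + 1) ≠ 0 := by positivity
    set S := ∑ p ∈ antidiagonal (j + 1), legendreLam p.1 * legendreLam p.2 with hS
    -- symmetrisations
    have hswap : ∑ p ∈ antidiagonal (j + 1), (p.2 : ℝ) * (legendreLam p.1 * legendreLam p.2) =
        ∑ p ∈ antidiagonal (j + 1), (p.1 : ℝ) * (legendreLam p.1 * legendreLam p.2) := by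
      rw [← Finset.Nat.sum_antidiagonal_swap]
      refine Finset.sum_congr rfl fun p _ => ?_
      simp only [Prod.fst_swap, Prod.snd_swap]
      ring
    have hswap' : ∑ p ∈ antidiagonal j, (p.2 : ℝ) * (legendreLam p.1 * legendreLam p.2) =
        ∑ p ∈ antidiagonal j, (p.1 : ℝ) * (legendreLam p.1 * legendreLam p.2) := by
      rw [← Finset.Nat.sum_antidiagonal_swap]
      refine Finset.sum_congr rfl fun p _ => ?_
      simp only [Prod.fst_swap, Prod.snd_swap]
      ring
    -- (j+1) S = Σ (i + r) λ_i λ_r = 2 Σ i λ_i λ_r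
    have h1 : ((j : ℝ) + 1) * S =
        2 * ∑ p ∈ antidiagonal (j + 1), (p.1 : ℝ) * (legendreLam p.1 * legendreLam p.2) := by
      rw [hS, Finset.mul_sum, two_mul]
      nth_rewrite 2 [← hswap]
      rw [← Finset.sum_add_distrib]
      refine Finset.sum_congr rfl fun p hp => ?_
      rw [mem_antidiagonal] at hp
      have : ((p.1 : ℝ) + p.2) = (j : ℝ) + 1 := by exact_mod_cast hp
      linear_combination (legendreLam p.1 * legendreLam p.2) * this.symm
    -- shift: the `i = 0` term vanishes
    have h2 : ∑ p ∈ antidiagonal (j + 1), (p.1 : ℝ) * (legendreLam p.1 * legendreLam p.2) =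
        ∑ p ∈ antidiagonal j, ((p.1 : ℝ) + 1) * (legendreLam (p.1 + 1) * legendreLam p.2) := by
      rw [Finset.Nat.sum_antidiagonal_succ]
      simp
    -- recurrence termwise: 2 (i+1) λ_{i+1} λ_r = (2 i + 1) λ_i λ_r
    have h3 : 2 * ∑ p ∈ antidiagonal j, ((p.1 : ℝ) + 1) * (legendreLam (p.1 + 1) * legendreLam p.2) =
        ∑ p ∈ antidiagonal j, (2 * (p.1 : ℝ) + 1) * (legendreLam p.1 * legendreLam p.2) := by
      rw [Finset.mul_sum]
      refine Finset.sum_congr rfl fun p _ => ?_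
      have h := legendreLam_succ_mul p.1
      linear_combination legendreLam p.2 * h
    -- Σ (2i+1) λ_i λ_r = Σ (i + r + 1) λ_i λ_r = (j + 1) Σ λ_i λ_r = (j+1)
    have h4 : ∑ p ∈ antidiagonal j, (2 * (p.1 : ℝ) + 1) * (legendreLam p.1 * legendreLam p.2) =
        ((j : ℝ) + 1) * 1 := by
      calc ∑ p ∈ antidiagonal j, (2 * (p.1 : ℝ) + 1) * (legendreLam p.1 * legendreLam p.2)
          = ∑ p ∈ antidiagonal j, (p.1 : ℝ) * (legendreLam p.1 * legendreLam p.2)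
              + ∑ p ∈ antidiagonal j, (p.1 : ℝ) * (legendreLam p.1 * legendreLam p.2)
              + ∑ p ∈ antidiagonal j, legendreLam p.1 * legendreLam p.2 := by
            rw [← Finset.sum_add_distrib, ← Finset.sum_add_distrib]
            exact Finset.sum_congr rfl fun p _ => by ring
        _ = ∑ p ∈ antidiagonal j, (p.1 : ℝ) * (legendreLam p.1 * legendreLam p.2)
              + ∑ p ∈ antidiagonal j, (p.2 : ℝ) * (legendreLam p.1 * legendreLam p.2)
              + ∑ p ∈ antidiagonal j, legendreLam p.1 * legendreLam p.2 := by rw [hswap']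
        _ = ∑ p ∈ antidiagonal j, ((p.1 : ℝ) + p.2) * (legendreLam p.1 * legendreLam p.2)
              + ∑ p ∈ antidiagonal j, legendreLam p.1 * legendreLam p.2 := by
            rw [← Finset.sum_add_distrib]
            congr 1
            exact Finset.sum_congr rfl fun p _ => by ring
        _ = ∑ p ∈ antidiagonal j, (j : ℝ) * (legendreLam p.1 * legendreLam p.2)
              + ∑ p ∈ antidiagonal j, legendreLam p.1 * legendreLam p.2 := by
            congr 1
            refine Finset.sum_congr rfl fun p hp => ?_
            rw [mem_antidiagonal] at hp
            have : ((p.1 : ℝ) + p.2) = (j : ℝ) := by exact_mod_cast hp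
            rw [this]
        _ = ((j : ℝ) + 1) * 1 := by rw [← Finset.mul_sum, ih]; ring
    have key : ((j : ℝ) + 1) * S = ((j : ℝ) + 1) * 1 := by
      rw [h1, h2, h3, h4]
    exact mul_left_cancel₀ hj key


/-! ### The Legendre-basis arrays and the two halves of the coefficient operator -/

/-- The monomial array of `s^{2α+2t+j} P_j(cos θ) / (z z̄)^α` (`z = s e^{iθ}`, `P_j` Legendre):
value `λ_{m-t} λ_{n-t}` at `(m,n)` with `t ≤ m`, `t ≤ n`, `m + n = 2t + j`, else `0`
(from `P_j(cos θ) = Σ_{i+r=j} λ_i λ_r e^{i(i-r)θ}`). [folklore] -/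
noncomputable def legendreArr (t j : ℕ) (p : ℕ × ℕ) : ℝ :=
  if t ≤ p.1 ∧ t ≤ p.2 ∧ p.1 + p.2 = 2 * t + j then
    legendreLam (p.1 - t) * legendreLam (p.2 - t) else 0

/-- Evaluation on the support. [folklore] -/
theorem legendreArr_pair (t j m n i r : ℕ) (hm : m = t + i) (hn : n = t + r) (h : i + r = j) :
    legendreArr t j (m, n) = legendreLam i * legendreLam r := by
  subst hm; subst hn
  unfold legendreArr
  rw [if_pos ⟨by omega, by omega, by omega⟩]
  simp

/-- Vanishing off the support. [folklore] -/
theorem legendreArr_pair_eq_zero (t j m n : ℕ) (h : m < t ∨ n < t ∨ m + n ≠ 2 * t + j) :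
    legendreArr t j (m, n) = 0 := by
  unfold legendreArr
  rw [if_neg]
  rintro ⟨h1, h2, h3⟩
  simp only at h1 h2 h3
  omega

/-- The arrays are symmetric. [folklore] -/
theorem legendreArr_symm (t j : ℕ) (p : ℕ × ℕ) : legendreArr t j (p.2, p.1) = legendreArr t j p := by
  unfold legendreArr
  simp only
  by_cases h : t ≤ p.1 ∧ t ≤ p.2 ∧ p.1 + p.2 = 2 * t + j
  · rw [if_pos ⟨h.2.1, h.1, by omega⟩, if_pos h, mul_comm]
  · rw [if_neg, if_neg h]
    rintro ⟨h1, h2, h3⟩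
    exact h ⟨h2, h1, by omega⟩

/-- The arrays are entrywise non-negative. [folklore] -/
theorem legendreArr_nonneg (t j : ℕ) (p : ℕ × ℕ) : 0 ≤ legendreArr t j p := by
  unfold legendreArr
  split_ifs
  · exact mul_nonneg (legendreLam_pos _).le (legendreLam_pos _).le
  · exact le_rfl

/-- The antidiagonal sum of `e_{t,j}` is `P_j(1) = 1`. [folklore] -/
theorem sum_antidiagonal_legendreArr (t j : ℕ) :
    ∑ p ∈ antidiagonal (2 * t + j), legendreArr t j p = 1 := by
  rw [← sum_antidiagonal_legendreLam_mul j]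
  -- reindex p = (t + i, t + r)
  rw [Finset.Nat.sum_antidiagonal_eq_sum_range_succ_mk, Finset.Nat.sum_antidiagonal_eq_sum_range_succ_mk]
  -- Σ_{m < 2t+j+1} e(m, 2t+j-m) = Σ_{i < j+1} λ_i λ_{j-i}
  have hsplit : ∑ m ∈ range (2 * t + j + 1), legendreArr t j (m, 2 * t + j - m) =
      ∑ m ∈ range (t + (j + 1) + t), legendreArr t j (m, 2 * t + j - m) := by
    congr 1; congr 1; omega
  rw [hsplit, Finset.sum_range_add, Finset.sum_range_add]
  have h0 : ∑ m ∈ range t, legendreArr t j (m, 2 * t + j - m) = 0 :=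
    Finset.sum_eq_zero fun m hm => legendreArr_pair_eq_zero _ _ _ _ (Or.inl (mem_range.mp hm))
  have h2 : ∑ m ∈ range t, legendreArr t j (t + (j + 1) + m, 2 * t + j - (t + (j + 1) + m)) = 0 :=
    Finset.sum_eq_zero fun m hm =>
      legendreArr_pair_eq_zero _ _ _ _ (Or.inr (Or.inl (by have := mem_range.mp hm; omega)))
  rw [h0, h2, zero_add, add_zero]
  refine Finset.sum_congr rfl fun i hi => ?_
  rw [mem_range] at hi
  exact legendreArr_pair t j _ _ i (j - i) (by omega) (by omega) (by omega)

/-- `[(z - z̄) f](P,Q) = f(P-1,Q) - f(P,Q-1)` on arrays (terms with a negative index absent). [folklore] -/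
noncomputable def zdiff (f : ℕ × ℕ → ℝ) (P Q : ℕ) : ℝ :=
  (if 1 ≤ P then f (P - 1, Q) else 0) - (if 1 ≤ Q then f (P, Q - 1) else 0)

/-- The degree-raising-by-one half of `coeffCasimirLHS` (weights `A`, `B`; independent of `a, b`).
[cite: DolanOsborn2011, §2 eqs. (2.10)–(2.12)] -/
noncomputable def coeffLAB (Δ : ℝ) (ℓ : ℕ) (k : ℕ × ℕ → ℝ) (P Q : ℕ) : ℝ :=
  (if 1 ≤ P then coeffA Δ ℓ (P - 1) Q * k (P - 1, Q) else 0) +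
    (if 1 ≤ Q then coeffB Δ ℓ P (Q - 1) * k (P, Q - 1) else 0)

/-- The degree-raising-by-two half of `coeffCasimirLHS` (weights `C`, `D`, `E`).
[cite: DolanOsborn2011, §2 eqs. (2.10)–(2.12)] -/
noncomputable def coeffLCDE (a b Δ : ℝ) (ℓ : ℕ) (k : ℕ × ℕ → ℝ) (P Q : ℕ) : ℝ :=
  (if 2 ≤ P then coeffC a b Δ ℓ (P - 2) * k (P - 2, Q) else 0) +
    (if 1 ≤ P ∧ 1 ≤ Q then coeffD a b Δ ℓ (P - 1) (Q - 1) * k (P - 1, Q - 1) else 0) +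
    (if 2 ≤ Q then coeffE a b Δ ℓ (Q - 2) * k (P, Q - 2) else 0)

/-- `coeffCasimirLHS = coeffLAB + coeffLCDE`. [folklore] -/
theorem coeffCasimirLHS_eq_add (a b Δ : ℝ) (ℓ : ℕ) (k : ℕ × ℕ → ℝ) (P Q : ℕ) :
    coeffCasimirLHS a b Δ ℓ k P Q = coeffLAB Δ ℓ k P Q + coeffLCDE a b Δ ℓ k P Q := by
  unfold coeffCasimirLHS coeffLAB coeffLCDE
  ring

/-- `coeffLAB` only sees the array at `(P-1,Q)` and `(P,Q-1)`. [folklore] -/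
theorem coeffLAB_congr (Δ : ℝ) (ℓ : ℕ) {k k' : ℕ × ℕ → ℝ} {P Q : ℕ}
    (h1 : 1 ≤ P → k (P - 1, Q) = k' (P - 1, Q)) (h2 : 1 ≤ Q → k (P, Q - 1) = k' (P, Q - 1)) :
    coeffLAB Δ ℓ k P Q = coeffLAB Δ ℓ k' P Q := by
  unfold coeffLAB
  split_ifs with hP hQ hQ' <;> simp [*]

/-- `coeffLCDE` only sees the array at `(P-2,Q)`, `(P-1,Q-1)`, `(P,Q-2)`. [folklore] -/
theorem coeffLCDE_congr (a b Δ : ℝ) (ℓ : ℕ) {k k' : ℕ × ℕ → ℝ} {P Q : ℕ}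
    (h1 : 2 ≤ P → k (P - 2, Q) = k' (P - 2, Q))
    (h2 : 1 ≤ P → 1 ≤ Q → k (P - 1, Q - 1) = k' (P - 1, Q - 1))
    (h3 : 2 ≤ Q → k (P, Q - 2) = k' (P, Q - 2)) :
    coeffLCDE a b Δ ℓ k P Q = coeffLCDE a b Δ ℓ k' P Q := by
  unfold coeffLCDE
  split_ifs with hP hPQ hQ hQ2 hPQ' hQ3 hQ4 <;> simp_all

/-- Linearity of `coeffLAB` over finite linear combinations of arrays. [folklore] -/
theorem coeffLAB_sum (Δ : ℝ) (ℓ : ℕ) (s : Finset ℕ) (c : ℕ → ℝ) (f : ℕ → ℕ × ℕ → ℝ) (P Q : ℕ) :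
    coeffLAB Δ ℓ (fun p => ∑ x ∈ s, c x * f x p) P Q = ∑ x ∈ s, c x * coeffLAB Δ ℓ (f x) P Q := by
  unfold coeffLAB
  split_ifs <;>
    simp only [Finset.mul_sum, ← Finset.sum_add_distrib, mul_zero, add_zero, zero_add,
      Finset.sum_const_zero] <;>
    exact Finset.sum_congr rfl fun x _ => by ring

/-- Linearity of `coeffLCDE` over finite linear combinations of arrays. [folklore] -/
theorem coeffLCDE_sum (a b Δ : ℝ) (ℓ : ℕ) (s : Finset ℕ) (c : ℕ → ℝ) (f : ℕ → ℕ × ℕ → ℝ)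
    (P Q : ℕ) :
    coeffLCDE a b Δ ℓ (fun p => ∑ x ∈ s, c x * f x p) P Q =
      ∑ x ∈ s, c x * coeffLCDE a b Δ ℓ (f x) P Q := by
  unfold coeffLCDE
  split_ifs <;>
    simp only [Finset.mul_sum, ← Finset.sum_add_distrib, mul_zero, add_zero, zero_add,
      Finset.sum_const_zero] <;>
    exact Finset.sum_congr rfl fun x _ => by ring

/-- Linearity of `zdiff`. [folklore] -/
theorem zdiff_sum (s : Finset ℕ) (c : ℕ → ℝ) (f : ℕ → ℕ × ℕ → ℝ) (P Q : ℕ) :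
    zdiff (fun p => ∑ x ∈ s, c x * f x p) P Q = ∑ x ∈ s, c x * zdiff (f x) P Q := by
  unfold zdiff
  split_ifs <;>
    simp only [← Finset.sum_sub_distrib, mul_zero, sub_zero, zero_sub,
      Finset.sum_const_zero, mul_sub, Finset.sum_neg_distrib, mul_neg]


/-! ### Identity I: `𝒟₀ 𝒫_{E,j} = C_{E,j} 𝒫_{E,j}` coefficientwise -/

/-- The level-`E` Casimir shift `c_{E,j} - c_{Δ,ℓ}` for `E = Δ + 2t + j - ℓ` (half the
Hogervorst–Rychkov pivot when `2t + j = ℓ + n`). [cite: HogervorstRychkov2013, §3 eq. (3.9)] -/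
noncomputable def casShift (Δ : ℝ) (ℓ t j : ℕ) : ℝ :=
  casimirEigenvalue3D (Δ + ((2 * t + j : ℕ) : ℝ) - ℓ) j - casimirEigenvalue3D Δ ℓ

/-- `2 · casShift = casimirPivot3D` at level `n = 2t + j - ℓ`. [cite: HogervorstRychkov2013, §3 eq. (3.9)] -/
theorem two_mul_casShift (Δ : ℝ) {ℓ t j n : ℕ} (hn : 2 * t + j = ℓ + n) :
    2 * casShift Δ ℓ t j = casimirPivot3D Δ ℓ n j := by
  unfold casShift casimirEigenvalue3D casimirPivot3D
  have h : ((2 * t + j : ℕ) : ℝ) = (ℓ : ℝ) + (n : ℝ) := by exact_mod_cast hn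
  rw [h]
  ring

/-- **Identity I** (the homogeneous part `𝒟₀` of the Casimir operator is diagonal on
`s^E P_j(cos θ)` with eigenvalue `C_{E,j}`, Hogervorst–Rychkov 2013 eq. (3.7), written
coefficientwise in the monomial basis): on output degree `2t + j + 1`,
`coeffLAB (e_{t,j}) = (c_{E,j} - c_{Δ,ℓ}) · [(z - z̄) e_{t,j}]`. Elementary: five cases in the
position of the target on the antidiagonal, each a rational identity after `λ_{i+1} = λ_i (2i+1)/(2i+2)`.
[cite: HogervorstRychkov2013, §3 eqs. (3.6)–(3.7)] -/
theorem coeffLAB_legendreArr (Δ : ℝ) (ℓ t j P Q : ℕ) (hPQ : P + Q = 2 * t + j + 1) :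
    coeffLAB Δ ℓ (legendreArr t j) P Q = casShift Δ ℓ t j * zdiff (legendreArr t j) P Q := by
  rcases (show P < t ∨ P = t ∨ (t + 1 ≤ P ∧ P ≤ t + j) ∨ P = t + j + 1 ∨ t + j + 2 ≤ P by omega)
    with h | h | ⟨h1, h2⟩ | h | h
  · -- left of the support: everything vanishes
    unfold coeffLAB zdiff
    rw [legendreArr_pair_eq_zero t j (P - 1) Q (by omega),
      legendreArr_pair_eq_zero t j P (Q - 1) (by omega)]
    simp
  · -- P = t: only the `B`-source `(t, t+j)`; `B(t,t+j) = -(c_{E,j} - c)`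
    have hQ1 : 1 ≤ Q := by omega
    simp only [coeffLAB, zdiff, hQ1, if_true]
    rw [legendreArr_pair_eq_zero t j (P - 1) Q (by omega),
      legendreArr_pair t j P (Q - 1) 0 j (by omega) (by omega) (by omega)]
    rw [show Q - 1 = t + j by omega]
    subst h
    unfold coeffB casShift halfTwist casimirEigenvalue3D
    split_ifs <;> push_cast <;> ring
  · -- generic: sources `(t+i, t+r'+1)` and `(t+i+1, t+r')`, `i + r' + 1 = j`
    obtain ⟨i, r', hP, hQ, hj⟩ : ∃ i r', P = t + i + 1 ∧ Q = t + r' + 1 ∧ j = i + r' + 1 :=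
      ⟨P - t - 1, Q - t - 1, by omega, by omega, by omega⟩
    have hP1 : 1 ≤ P := by omega
    have hQ1 : 1 ≤ Q := by omega
    simp only [coeffLAB, zdiff, hP1, hQ1, if_true]
    rw [legendreArr_pair t j (P - 1) Q i (r' + 1) (by omega) (by omega) (by omega),
      legendreArr_pair t j P (Q - 1) (i + 1) r' (by omega) (by omega) (by omega)]
    rw [show P - 1 = t + i by omega, show Q - 1 = t + r' by omega]
    subst hP hQ hj
    rw [legendreLam_succ i, legendreLam_succ r']
    unfold coeffA coeffB casShift halfTwist casimirEigenvalue3D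
    have hi : (2 * (i : ℝ) + 2) ≠ 0 := by positivity
    have hr : (2 * (r' : ℝ) + 2) ≠ 0 := by positivity
    push_cast
    field_simp
    ring
  · -- P = t+j+1: only the `A`-source `(t+j, t)`; `A(t+j,t) = c_{E,j} - c`
    have hP1 : 1 ≤ P := by omega
    simp only [coeffLAB, zdiff, hP1, if_true]
    rw [legendreArr_pair t j (P - 1) Q j 0 (by omega) (by omega) (by omega),
      legendreArr_pair_eq_zero t j P (Q - 1) (by omega)]
    rw [show P - 1 = t + j by omega, show Q = t by omega]
    unfold coeffA casShift halfTwist casimirEigenvalue3D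
    split_ifs <;> push_cast <;> ring
  · -- right of the support
    unfold coeffLAB zdiff
    rw [legendreArr_pair_eq_zero t j (P - 1) Q (by omega),
      legendreArr_pair_eq_zero t j P (Q - 1) (by omega)]
    simp


/-! ### Identity II: `𝒟₁ 𝒫_{E,j} = -γ⁺ 𝒫_{E+1,j+1} - γ⁻ 𝒫_{E+1,j-1}` coefficientwise -/

/-- The level parameter `E = Δ + 2t + j - ℓ` of the array `e_{t,j}` (so `E = Δ + n` at level
`n = 2t + j - ℓ`). [cite: HogervorstRychkov2013, §3 eq. (3.6)] -/
noncomputable def levelE (Δ : ℝ) (ℓ t j : ℕ) : ℝ :=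
  Δ + ((2 * t + j : ℕ) : ℝ) - ℓ

/-- **Identity II** (the degree-raising part `𝒟₁` of the Casimir operator maps `s^E P_j` to
`-γ⁺_{E,j} s^{E+1} P_{j+1} - γ⁻_{E,j} s^{E+1} P_{j-1}`, Hogervorst–Rychkov 2013 eq. (3.8), at
`d = 3`, written coefficientwise in the monomial basis, in the normalisation of `CasimirEq3D`, which
carries an overall factor `1/2` relative to theirs): on output degree `2t + j + 2`,
`coeffLCDE (e_{t,j}) = -(γ⁺/2)·[(z - z̄) e_{t,j+1}] - (γ⁻/2)·[(z - z̄) e_{t+1,j-1}]` (`a = b = 0`).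
Elementary: seven cases in the position of the target, each a rational identity after the
`λ`-recurrence. [cite: HogervorstRychkov2013, §3 eq. (3.8)] -/
theorem coeffLCDE_legendreArr (Δ : ℝ) (ℓ t j P Q : ℕ) (hPQ : P + Q = 2 * t + j + 2) :
    coeffLCDE 0 0 Δ ℓ (legendreArr t j) P Q =
      -(hrGammaPlus (levelE Δ ℓ t j) j / 2) * zdiff (legendreArr t (j + 1)) P Q
        - (hrGammaMinus (levelE Δ ℓ t j) j / 2) * zdiff (legendreArr (t + 1) (j - 1)) P Q := by
  have hj0 : (2 * (j : ℝ) + 1) ≠ 0 := by positivity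
  rcases (show P < t ∨ P = t ∨ P = t + 1 ∨ (t + 2 ≤ P ∧ P ≤ t + j) ∨ (P = t + j + 1 ∧ 1 ≤ j) ∨
      P = t + j + 2 ∨ t + j + 3 ≤ P by omega) with h | h | h | ⟨h1, h2⟩ | ⟨h, hj⟩ | h | h
  · -- (a) left of everything
    unfold coeffLCDE zdiff
    rw [legendreArr_pair_eq_zero t j (P - 2) Q (by omega),
      legendreArr_pair_eq_zero t j (P - 1) (Q - 1) (by omega),
      legendreArr_pair_eq_zero t j P (Q - 2) (by omega),
      legendreArr_pair_eq_zero t (j + 1) (P - 1) Q (by omega),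
      legendreArr_pair_eq_zero t (j + 1) P (Q - 1) (by omega),
      legendreArr_pair_eq_zero (t + 1) (j - 1) (P - 1) Q (by omega),
      legendreArr_pair_eq_zero (t + 1) (j - 1) P (Q - 1) (by omega)]
    simp
  · -- (b) P = t: `E`-source `(t, t+j)` against `e_{t,j+1}(t, t+j+1)`
    have g3 : 2 ≤ Q := by omega
    have g5 : 1 ≤ Q := by omega
    unfold coeffLCDE zdiff
    rw [legendreArr_pair_eq_zero t j (P - 2) Q (by omega),
      legendreArr_pair_eq_zero t j (P - 1) (Q - 1) (by omega),
      legendreArr_pair t j P (Q - 2) 0 j (by omega) (by omega) (by omega),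
      legendreArr_pair_eq_zero t (j + 1) (P - 1) Q (by omega),
      legendreArr_pair t (j + 1) P (Q - 1) 0 (j + 1) (by omega) (by omega) (by omega),
      legendreArr_pair_eq_zero (t + 1) (j - 1) (P - 1) Q (by omega),
      legendreArr_pair_eq_zero (t + 1) (j - 1) P (Q - 1) (by omega)]
    simp only [mul_zero, ite_self, zero_add, add_zero, sub_zero, zero_sub, g3, g5, if_true]
    rw [show Q - 2 = t + j by omega, legendreLam_succ j]
    unfold coeffE hrGammaPlus levelE halfTwist
    push_cast
    field_simp
    ring
  · -- (c) P = t+1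
    rcases Nat.eq_zero_or_pos j with hj | hj
    · -- j = 0: both sides vanish (`D(t,t) = 0`)
      subst hj
      have g2 : 1 ≤ P ∧ 1 ≤ Q := ⟨by omega, by omega⟩
      unfold coeffLCDE zdiff
      rw [legendreArr_pair_eq_zero t 0 (P - 2) Q (by omega),
        legendreArr_pair t 0 (P - 1) (Q - 1) 0 0 (by omega) (by omega) (by omega),
        legendreArr_pair_eq_zero t 0 P (Q - 2) (by omega),
        legendreArr_pair t (0 + 1) (P - 1) Q 0 1 (by omega) (by omega) (by omega),
        legendreArr_pair t (0 + 1) P (Q - 1) 1 0 (by omega) (by omega) (by omega),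
        legendreArr_pair_eq_zero (t + 1) (0 - 1) (P - 1) Q (by omega),
        legendreArr_pair_eq_zero (t + 1) (0 - 1) P (Q - 1) (by omega)]
      simp only [mul_zero, ite_self, zero_add, add_zero, sub_zero, g2, if_true, and_self]
      rw [show P - 1 = t by omega, show Q - 1 = t by omega]
      unfold coeffD
      ring
    · obtain ⟨j', rfl⟩ : ∃ j', j = j' + 1 := ⟨j - 1, by omega⟩
      have g2 : 1 ≤ P ∧ 1 ≤ Q := ⟨by omega, by omega⟩
      have g3 : 2 ≤ Q := by omega
      unfold coeffLCDE zdiff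
      rw [legendreArr_pair_eq_zero t (j' + 1) (P - 2) Q (by omega),
        legendreArr_pair t (j' + 1) (P - 1) (Q - 1) 0 (j' + 1) (by omega) (by omega) (by omega),
        legendreArr_pair t (j' + 1) P (Q - 2) 1 j' (by omega) (by omega) (by omega),
        legendreArr_pair t (j' + 1 + 1) (P - 1) Q 0 (j' + 2) (by omega) (by omega) (by omega),
        legendreArr_pair t (j' + 1 + 1) P (Q - 1) 1 (j' + 1) (by omega) (by omega) (by omega),
        legendreArr_pair_eq_zero (t + 1) (j' + 1 - 1) (P - 1) Q (by omega),
        legendreArr_pair (t + 1) (j' + 1 - 1) P (Q - 1) 0 j' (by omega) (by omega) (by omega)]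
      simp only [mul_zero, ite_self, zero_add, zero_sub, g2, g3, if_true, and_self]
      rw [show P - 1 = t by omega, show Q - 1 = t + (j' + 1) by omega, show Q - 2 = t + j' by omega]
      rw [show j' + 2 = j' + 1 + 1 by ring, legendreLam_succ (j' + 1), legendreLam_succ j',
        legendreLam_one, legendreLam_zero]
      unfold coeffD coeffE hrGammaPlus hrGammaMinus levelE halfTwist
      have h1 : (2 * (j' : ℝ) + 2) ≠ 0 := by positivity
      have h2 : (2 * ((j' : ℝ) + 1) + 2) ≠ 0 := by positivity
      push_cast
      field_simp
      ring
  · -- (d) generic: P = t+i'+2, Q = t+r'+2, j = i'+r'+2; all seven values present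
    obtain ⟨i', r', hP, hQ, hj⟩ : ∃ i' r', P = t + i' + 2 ∧ Q = t + r' + 2 ∧ j = i' + r' + 2 :=
      ⟨P - t - 2, Q - t - 2, by omega, by omega, by omega⟩
    have g1 : 2 ≤ P := by omega
    have g2 : 1 ≤ P ∧ 1 ≤ Q := ⟨by omega, by omega⟩
    have g3 : 2 ≤ Q := by omega
    unfold coeffLCDE zdiff
    rw [legendreArr_pair t j (P - 2) Q i' (r' + 2) (by omega) (by omega) (by omega),
      legendreArr_pair t j (P - 1) (Q - 1) (i' + 1) (r' + 1) (by omega) (by omega) (by omega),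
      legendreArr_pair t j P (Q - 2) (i' + 2) r' (by omega) (by omega) (by omega),
      legendreArr_pair t (j + 1) (P - 1) Q (i' + 1) (r' + 2) (by omega) (by omega) (by omega),
      legendreArr_pair t (j + 1) P (Q - 1) (i' + 2) (r' + 1) (by omega) (by omega) (by omega),
      legendreArr_pair (t + 1) (j - 1) (P - 1) Q i' (r' + 1) (by omega) (by omega) (by omega),
      legendreArr_pair (t + 1) (j - 1) P (Q - 1) (i' + 1) r' (by omega) (by omega) (by omega)]
    simp only [g1, g2, g3, if_true, and_self]
    rw [show P - 2 = t + i' by omega, show P - 1 = t + i' + 1 by omega, show Q - 1 = t + r' + 1 by omega,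
      show Q - 2 = t + r' by omega]
    subst hj
    rw [show i' + 2 = i' + 1 + 1 by ring, show r' + 2 = r' + 1 + 1 by ring,
      legendreLam_succ (i' + 1), legendreLam_succ i', legendreLam_succ (r' + 1), legendreLam_succ r']
    unfold coeffC coeffD coeffE hrGammaPlus hrGammaMinus levelE halfTwist
    have h1 : (2 * (i' : ℝ) + 2) ≠ 0 := by positivity
    have h2 : (2 * ((i' : ℝ) + 1) + 2) ≠ 0 := by positivity
    have h3 : (2 * (r' : ℝ) + 2) ≠ 0 := by positivity
    have h4 : (2 * ((r' : ℝ) + 1) + 2) ≠ 0 := by positivity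
    push_cast
    field_simp
    ring
  · -- (e) P = t+j+1, j ≥ 1: mirror of (c)
    obtain ⟨j', rfl⟩ : ∃ j', j = j' + 1 := ⟨j - 1, by omega⟩
    have g1 : 2 ≤ P := by omega
    have g2 : 1 ≤ P ∧ 1 ≤ Q := ⟨by omega, by omega⟩
    unfold coeffLCDE zdiff
    rw [legendreArr_pair t (j' + 1) (P - 2) Q j' 1 (by omega) (by omega) (by omega),
      legendreArr_pair t (j' + 1) (P - 1) (Q - 1) (j' + 1) 0 (by omega) (by omega) (by omega),
      legendreArr_pair_eq_zero t (j' + 1) P (Q - 2) (by omega),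
      legendreArr_pair t (j' + 1 + 1) (P - 1) Q (j' + 1) 1 (by omega) (by omega) (by omega),
      legendreArr_pair t (j' + 1 + 1) P (Q - 1) (j' + 2) 0 (by omega) (by omega) (by omega),
      legendreArr_pair (t + 1) (j' + 1 - 1) (P - 1) Q j' 0 (by omega) (by omega) (by omega),
      legendreArr_pair_eq_zero (t + 1) (j' + 1 - 1) P (Q - 1) (by omega)]
    simp only [mul_zero, ite_self, add_zero, sub_zero, g1, g2, if_true, and_self]
    rw [show P - 2 = t + j' by omega, show P - 1 = t + (j' + 1) by omega, show Q - 1 = t by omega]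
    rw [show j' + 2 = j' + 1 + 1 by ring, legendreLam_succ (j' + 1), legendreLam_succ j',
      legendreLam_one, legendreLam_zero]
    unfold coeffC coeffD hrGammaPlus hrGammaMinus levelE halfTwist
    have h1 : (2 * (j' : ℝ) + 2) ≠ 0 := by positivity
    have h2 : (2 * ((j' : ℝ) + 1) + 2) ≠ 0 := by positivity
    push_cast
    field_simp
    ring
  · -- (f) P = t+j+2: `C`-source `(t+j, t)` against `e_{t,j+1}(t+j+1, t)`
    have g1 : 2 ≤ P := by omega
    have g4 : 1 ≤ P := by omega
    unfold coeffLCDE zdiff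
    rw [legendreArr_pair t j (P - 2) Q j 0 (by omega) (by omega) (by omega),
      legendreArr_pair_eq_zero t j (P - 1) (Q - 1) (by omega),
      legendreArr_pair_eq_zero t j P (Q - 2) (by omega),
      legendreArr_pair t (j + 1) (P - 1) Q (j + 1) 0 (by omega) (by omega) (by omega),
      legendreArr_pair_eq_zero t (j + 1) P (Q - 1) (by omega),
      legendreArr_pair_eq_zero (t + 1) (j - 1) (P - 1) Q (by omega),
      legendreArr_pair_eq_zero (t + 1) (j - 1) P (Q - 1) (by omega)]
    simp only [mul_zero, ite_self, add_zero, sub_zero, g1, g4, if_true]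
    rw [show P - 2 = t + j by omega, legendreLam_succ j]
    unfold coeffC hrGammaPlus levelE halfTwist
    push_cast
    field_simp
    ring
  · -- (g) right of everything
    unfold coeffLCDE zdiff
    rw [legendreArr_pair_eq_zero t j (P - 2) Q (by omega),
      legendreArr_pair_eq_zero t j (P - 1) (Q - 1) (by omega),
      legendreArr_pair_eq_zero t j P (Q - 2) (by omega),
      legendreArr_pair_eq_zero t (j + 1) (P - 1) Q (by omega),
      legendreArr_pair_eq_zero t (j + 1) P (Q - 1) (by omega),
      legendreArr_pair_eq_zero (t + 1) (j - 1) (P - 1) Q (by omega),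
      legendreArr_pair_eq_zero (t + 1) (j - 1) P (Q - 1) (by omega)]
    simp


/-! ### Degree-indexed form of the basis and of the two identities -/

/-- The degree-`N`, spin-`j` Legendre array `e_{N,j} := e_{(N-j)/2, j}` (zero unless `j ≤ N`,
`j ≡ N (mod 2)`): the monomial array of `𝒫_{Δ+N-ℓ, j} / (z z̄)^α`. [cite: HogervorstRychkov2013, §3 eq. (3.6)] -/
noncomputable def legendreArrDeg (N j : ℕ) : ℕ × ℕ → ℝ :=
  if j ≤ N ∧ (N + j) % 2 = 0 then legendreArr ((N - j) / 2) j else 0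

/-- `e_{N,j}` is supported on the antidiagonal of degree `N`. [folklore] -/
theorem legendreArrDeg_eq_zero_of_ne {N j : ℕ} {p : ℕ × ℕ} (h : p.1 + p.2 ≠ N) :
    legendreArrDeg N j p = 0 := by
  unfold legendreArrDeg
  split_ifs with hc
  · unfold legendreArr
    rw [if_neg]
    rintro ⟨_, _, h3⟩
    omega
  · rfl

/-- `e_{N,j}` is symmetric. [folklore] -/
theorem legendreArrDeg_symm (N j : ℕ) (p : ℕ × ℕ) :
    legendreArrDeg N j (p.2, p.1) = legendreArrDeg N j p := by
  unfold legendreArrDeg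
  split_ifs
  · exact legendreArr_symm _ _ p
  · rfl

/-- `e_{N,j} ≥ 0` entrywise. [folklore] -/
theorem legendreArrDeg_nonneg (N j : ℕ) (p : ℕ × ℕ) : 0 ≤ legendreArrDeg N j p := by
  unfold legendreArrDeg
  split_ifs
  · exact legendreArr_nonneg _ _ p
  · exact le_rfl

/-- `Σ_{m+n=N} e_{N,j}(m,n) = 1` on the range (`P_j(1) = 1`), else `0`. [folklore] -/
theorem sum_antidiagonal_legendreArrDeg (N j : ℕ) :
    ∑ p ∈ antidiagonal N, legendreArrDeg N j p = if j ≤ N ∧ (N + j) % 2 = 0 then 1 else 0 := by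
  unfold legendreArrDeg
  split_ifs with h
  · obtain ⟨t, ht⟩ : ∃ t, (N - j) / 2 = t := ⟨_, rfl⟩
    have hN : N = 2 * t + j := by omega
    subst hN
    rw [ht]
    exact sum_antidiagonal_legendreArr t j
  · simp

/-- The Casimir shift in degree form: `c_{Δ+N-ℓ, j} - c_{Δ,ℓ}`. [cite: HogervorstRychkov2013, §3 eq. (3.9)] -/
noncomputable def casShiftDeg (Δ : ℝ) (ℓ N j : ℕ) : ℝ :=
  casimirEigenvalue3D (Δ + (N : ℝ) - ℓ) j - casimirEigenvalue3D Δ ℓ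

/-- `2 (c_{Δ+n, j} - c_{Δ,ℓ}) = casimirPivot3D Δ ℓ n j`. [cite: HogervorstRychkov2013, §3 eq. (3.9)] -/
theorem two_mul_casShiftDeg (Δ : ℝ) (ℓ n j : ℕ) :
    2 * casShiftDeg Δ ℓ (ℓ + n) j = casimirPivot3D Δ ℓ n j := by
  unfold casShiftDeg casimirEigenvalue3D casimirPivot3D
  push_cast
  ring

/-- Identity I in degree form. [cite: HogervorstRychkov2013, §3 eqs. (3.6)–(3.7)] -/
theorem coeffLAB_legendreArrDeg (Δ : ℝ) (ℓ N j P Q : ℕ) (hPQ : P + Q = N + 1) :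
    coeffLAB Δ ℓ (legendreArrDeg N j) P Q = casShiftDeg Δ ℓ N j * zdiff (legendreArrDeg N j) P Q := by
  unfold legendreArrDeg
  split_ifs with h
  · have hN : ((2 * ((N - j) / 2) + j : ℕ) : ℝ) = (N : ℝ) := by
      have : 2 * ((N - j) / 2) + j = N := by omega
      exact_mod_cast this
    have hcs : casShift Δ ℓ ((N - j) / 2) j = casShiftDeg Δ ℓ N j := by
      unfold casShift casShiftDeg
      rw [hN]
    rw [← hcs]
    exact coeffLAB_legendreArr Δ ℓ _ j P Q (by omega)
  · simp [coeffLAB, zdiff]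

/-- Identity II in degree form (for `j ≤ N`). [cite: HogervorstRychkov2013, §3 eq. (3.8)] -/
theorem coeffLCDE_legendreArrDeg (Δ : ℝ) (ℓ N j P Q : ℕ) (hPQ : P + Q = N + 2) (hjN : j ≤ N) :
    coeffLCDE 0 0 Δ ℓ (legendreArrDeg N j) P Q =
      -(hrGammaPlus (Δ + (N : ℝ) - ℓ) j / 2) * zdiff (legendreArrDeg (N + 1) (j + 1)) P Q
        - (hrGammaMinus (Δ + (N : ℝ) - ℓ) j / 2) * zdiff (legendreArrDeg (N + 1) (j - 1)) P Q := by
  by_cases h : (N + j) % 2 = 0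
  · have hN' : 2 * ((N - j) / 2) + j = N := by omega
    have hN : ((2 * ((N - j) / 2) + j : ℕ) : ℝ) = (N : ℝ) := by exact_mod_cast hN'
    have hE : levelE Δ ℓ ((N - j) / 2) j = Δ + (N : ℝ) - ℓ := by
      unfold levelE; rw [hN]
    have h1 : legendreArrDeg N j = legendreArr ((N - j) / 2) j := by
      unfold legendreArrDeg; rw [if_pos ⟨hjN, h⟩]
    have h2 : legendreArrDeg (N + 1) (j + 1) = legendreArr ((N - j) / 2) (j + 1) := by
      unfold legendreArrDeg
      rw [if_pos ⟨by omega, by omega⟩]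
      congr 1
      omega
    rcases Nat.eq_zero_or_pos j with hj | hj
    · subst hj
      rw [h1, h2, hrGammaMinus_zero, ← hE]
      have := coeffLCDE_legendreArr Δ ℓ ((N - 0) / 2) 0 P Q (by omega)
      rw [hrGammaMinus_zero] at this
      simpa using this
    · have h3 : legendreArrDeg (N + 1) (j - 1) = legendreArr ((N - j) / 2 + 1) (j - 1) := by
        unfold legendreArrDeg
        rw [if_pos ⟨by omega, by omega⟩]
        congr 1
        omega
      rw [h1, h2, h3, ← hE]
      exact coeffLCDE_legendreArr Δ ℓ _ j P Q (by omega)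
  · -- wrong parity: everything vanishes (`e_{N,j} = 0`, `e_{N+1,j±1} = 0` or `γ⁻_{E,0} = 0`)
    have h1 : legendreArrDeg N j = 0 := by
      unfold legendreArrDeg; rw [if_neg (fun hc => h hc.2)]
    have h2 : legendreArrDeg (N + 1) (j + 1) = 0 := by
      unfold legendreArrDeg; rw [if_neg (fun hc => by omega)]
    rcases Nat.eq_zero_or_pos j with hj | hj
    · subst hj
      rw [h1, h2, hrGammaMinus_zero]
      simp [coeffLCDE, zdiff]
    · have h3 : legendreArrDeg (N + 1) (j - 1) = 0 := by
        unfold legendreArrDeg; rw [if_neg (fun hc => by omega)]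
      rw [h1, h2, h3]
      simp [coeffLCDE, zdiff]

/-! ### The Hogervorst–Rychkov solution in the monomial basis -/

/-- The degree-`N` slice of the HR solution: `Σ_j (A_{N-ℓ, j} / λ_ℓ) e_{N,j}` (Dolan–Osborn
normalisation `k_{ℓ,0} = 1`; HR normalise the leading term to `𝒫_{Δ,ℓ}`, whose `z^{α+ℓ} z̄^{α}`
coefficient is `λ_ℓ`). [cite: HogervorstRychkov2013, §3 eqs. (3.4)–(3.6)] -/
noncomputable def hrSlice (Δ : ℝ) (ℓ N : ℕ) (p : ℕ × ℕ) : ℝ :=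
  ∑ j ∈ range (N + 1), (hrCoeff Δ ℓ (N - ℓ) j / legendreLam ℓ) * legendreArrDeg N j p

/-- **The block's double-power-series coefficients from the `z`-series**: `k_{mn}` for
`m + n = N ≥ ℓ` is `Σ_j (A_{N-ℓ,j}/λ_ℓ) e_{N,j}(m,n) = λ_ℓ⁻¹ Σ_{t ≤ min(m,n)} A_{N-ℓ, N-2t} λ_{m-t} λ_{n-t}`
(the expansion of `Σ_{n,j} A_{n,j} 𝒫_{Δ+n,j}` in monomials `z^{α+m} z̄^{α+n}` via
`P_j(cos θ) = Σ_{i+r=j} λ_i λ_r e^{i(i-r)θ}`), and `0` below degree `ℓ`.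
[cite: HogervorstRychkov2013, §3 eqs. (3.4)–(3.6)] -/
noncomputable def hrMonomialCoeff (Δ : ℝ) (ℓ : ℕ) (p : ℕ × ℕ) : ℝ :=
  if ℓ ≤ p.1 + p.2 then hrSlice Δ ℓ (p.1 + p.2) p else 0

/-- Slices are supported on their degree. [folklore] -/
theorem hrSlice_eq_zero_of_ne (Δ : ℝ) (ℓ : ℕ) {N : ℕ} {p : ℕ × ℕ} (h : p.1 + p.2 ≠ N) :
    hrSlice Δ ℓ N p = 0 :=
  Finset.sum_eq_zero fun j _ => by rw [legendreArrDeg_eq_zero_of_ne h, mul_zero]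

/-- On degree `N ≥ ℓ` the array is its degree-`N` slice. [folklore] -/
theorem hrMonomialCoeff_eq_slice (Δ : ℝ) (ℓ : ℕ) {N : ℕ} {p : ℕ × ℕ} (h : p.1 + p.2 = N)
    (hℓ : ℓ ≤ N) : hrMonomialCoeff Δ ℓ p = hrSlice Δ ℓ N p := by
  unfold hrMonomialCoeff
  rw [if_pos (by omega), h]

/-- Below degree `ℓ` the array vanishes. [folklore] -/
theorem hrMonomialCoeff_eq_zero_of_lt (Δ : ℝ) (ℓ : ℕ) {p : ℕ × ℕ} (h : p.1 + p.2 < ℓ) :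
    hrMonomialCoeff Δ ℓ p = 0 := by
  unfold hrMonomialCoeff
  rw [if_neg (by omega)]

/-- The HR array is symmetric. [folklore] -/
theorem hrMonomialCoeff_symm (Δ : ℝ) (ℓ : ℕ) (p : ℕ × ℕ) :
    hrMonomialCoeff Δ ℓ (p.2, p.1) = hrMonomialCoeff Δ ℓ p := by
  unfold hrMonomialCoeff hrSlice
  simp only
  rw [Nat.add_comm p.2 p.1]
  split_ifs
  · exact Finset.sum_congr rfl fun j _ => by rw [legendreArrDeg_symm]
  · rfl

/-- The HR array satisfies the Dolan–Osborn boundary condition `k_{m,0} = 0 (m < ℓ)`,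
`k_{ℓ,0} = 1`. [cite: HogervorstRychkov2013, §3 eq. (3.9)] -/
theorem hrMonomialCoeff_hasLeadingPart (Δ : ℝ) (ℓ : ℕ) : HasLeadingPart ℓ (hrMonomialCoeff Δ ℓ) := by
  refine ⟨fun m hm => hrMonomialCoeff_eq_zero_of_lt Δ ℓ (by simpa using hm), ?_⟩
  rw [hrMonomialCoeff_eq_slice Δ ℓ (N := ℓ) (by simp) le_rfl]
  unfold hrSlice
  rw [Finset.sum_eq_single ℓ]
  · rw [Nat.sub_self, hrCoeff_zero_self]
    unfold legendreArrDeg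
    rw [if_pos ⟨le_rfl, by omega⟩, legendreArr_pair ((ℓ - ℓ) / 2) ℓ ℓ 0 ℓ 0 (by omega) (by omega)
      (by omega), legendreLam_zero, mul_one, div_mul_cancel₀ _ (legendreLam_ne_zero ℓ)]
  · intro j _ hj
    rw [Nat.sub_self, hrCoeff_zero_of_ne Δ hj, zero_div, zero_mul]
  · intro h
    exact absurd (mem_range.mpr (Nat.lt_succ_self ℓ)) h

/-- Above the unitarity bound the HR array is entrywise non-negative (`A_{n,j} ≥ 0`, `λ_i > 0`).
[cite: HogervorstRychkov2013, §3 after eq. (3.9)] -/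
theorem hrMonomialCoeff_nonneg {Δ : ℝ} {ℓ : ℕ} (hΔ : unitarityBound3D ℓ < Δ) (p : ℕ × ℕ) :
    0 ≤ hrMonomialCoeff Δ ℓ p := by
  unfold hrMonomialCoeff hrSlice
  split_ifs
  · exact Finset.sum_nonneg fun j _ =>
      mul_nonneg (div_nonneg (hrCoeff_nonneg hΔ _ _) (legendreLam_pos ℓ).le)
        (legendreArrDeg_nonneg _ _ _)
  · exact le_rfl

/-- **Diagonal sums**: `d_{ℓ+n} = Σ_{m+m'=ℓ+n} k_{mm'} = a_n(Δ,ℓ)/λ_ℓ` with `a_n = hrLevelSum Δ ℓ n`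
the level sum of the `z`-series coefficients (`P_j(1) = 1`); coefficients off the descendant range
vanish by `hrCoeff_support`. [cite: HogervorstRychkov2013, §3 eq. (3.4)] -/
theorem diagCoeff_hrMonomialCoeff (Δ : ℝ) (ℓ n : ℕ) :
    diagCoeff (hrMonomialCoeff Δ ℓ) (ℓ + n) = hrLevelSum Δ ℓ n / legendreLam ℓ := by
  unfold diagCoeff
  have h1 : ∑ p ∈ antidiagonal (ℓ + n), hrMonomialCoeff Δ ℓ p =
      ∑ p ∈ antidiagonal (ℓ + n), hrSlice Δ ℓ (ℓ + n) p :=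
    Finset.sum_congr rfl fun p hp => hrMonomialCoeff_eq_slice Δ ℓ (mem_antidiagonal.mp hp) (by omega)
  rw [h1]
  unfold hrSlice
  rw [Finset.sum_comm]
  simp_rw [← Finset.mul_sum, sum_antidiagonal_legendreArrDeg, Nat.add_sub_cancel_left]
  unfold hrLevelSum
  rw [Finset.sum_div]
  refine Finset.sum_congr rfl fun j hj => ?_
  split_ifs with hc
  · rw [mul_one]
  · have hj' := mem_range.mp hj
    rw [mul_zero, hrCoeff_eq_zero_of_not_inDescendantRange Δ (fun hr => hc ⟨by omega, ?_⟩), zero_div]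
    obtain ⟨_, _, h3⟩ := hr
    omega

/-- The HR recursion in multiplied-out form for ALL `(n+1, j)` above the unitarity bound: on the
descendant range the pivot is positive (`casimirPivot3D_pos`), off it both sides vanish (a child off
the range has both parents off the range). [cite: HogervorstRychkov2013, §3 eq. (3.9)] -/
theorem hrCoeff_succ_rec_all {Δ : ℝ} {ℓ : ℕ} (hΔ : unitarityBound3D ℓ < Δ) (n j : ℕ) :
    casimirPivot3D Δ ℓ (n + 1) j * hrCoeff Δ ℓ (n + 1) j =
      (if j = 0 then 0 else hrGammaPlus (Δ + n) (j - 1) * hrCoeff Δ ℓ n (j - 1)) +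
        hrGammaMinus (Δ + n) (j + 1) * hrCoeff Δ ℓ n (j + 1) := by
  by_cases hr : InDescendantRange ℓ (n + 1) j
  · obtain ⟨h1, h2, h3⟩ := hr
    exact hrCoeff_succ_rec (casimirPivot3D_pos hΔ (by omega) h1 h2 h3).ne'
  · rw [hrCoeff_eq_zero_of_not_inDescendantRange Δ hr, mul_zero]
    have hp : hrCoeff Δ ℓ n (j + 1) = 0 :=
      hrCoeff_eq_zero_of_not_inDescendantRange Δ fun ⟨h1, h2, h3⟩ => hr ⟨by omega, by omega, by omega⟩
    rw [hp, mul_zero, add_zero]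
    split_ifs with hj
    · rfl
    · have hm : hrCoeff Δ ℓ n (j - 1) = 0 :=
        hrCoeff_eq_zero_of_not_inDescendantRange Δ fun ⟨h1, h2, h3⟩ =>
          hr ⟨by omega, by omega, by omega⟩
      rw [hm, mul_zero]


/-! ### Assembly: the HR array solves the coefficient system -/

/-- The finite-sum bookkeeping of the assembly, abstracted: if `piv_j a¹_j = [j≥1] γ⁺_{j-1} a²_{j-1}
+ γ⁻_{j+1} a²_{j+1}` for all `j` (the recursion), `γ⁻_0 = 0` and `a²` vanishes beyond `K`, then
`Σ_{j ≤ K+1} piv_j a¹_j Z_j - Σ_{j ≤ K} γ⁺_j a²_j Z_{j+1} - Σ_{j ≤ K} γ⁻_j a²_j Z_{j-1} = 0`. [folklore] -/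
theorem sum_recursion_cancel (K : ℕ) (a₁ a₂ piv gp gm Z : ℕ → ℝ)
    (hrec : ∀ j, piv j * a₁ j = (if j = 0 then 0 else gp (j - 1) * a₂ (j - 1)) + gm (j + 1) * a₂ (j + 1))
    (hgm0 : gm 0 = 0) (hK1 : a₂ (K + 1) = 0) (hK2 : a₂ (K + 2) = 0) :
    ∑ j ∈ range (K + 2), piv j * a₁ j * Z j - ∑ j ∈ range (K + 1), gp j * a₂ j * Z (j + 1)
      - ∑ j ∈ range (K + 1), gm j * a₂ j * Z (j - 1) = 0 := by
  have hp : ∑ j ∈ range (K + 1), gp j * a₂ j * Z (j + 1) =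
      ∑ j ∈ range (K + 2), (if j = 0 then 0 else gp (j - 1) * a₂ (j - 1)) * Z j := by
    rw [Finset.sum_range_succ' (fun j => (if j = 0 then 0 else gp (j - 1) * a₂ (j - 1)) * Z j)]
    simp
  have hm : ∑ j ∈ range (K + 1), gm j * a₂ j * Z (j - 1) =
      ∑ j ∈ range (K + 2), gm (j + 1) * a₂ (j + 1) * Z j := by
    rw [Finset.sum_range_succ' (fun j => gm j * a₂ j * Z (j - 1)), hgm0]
    rw [Finset.sum_range_succ (fun j => gm (j + 1) * a₂ (j + 1) * Z j) (K + 1),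
      Finset.sum_range_succ (fun j => gm (j + 1) * a₂ (j + 1) * Z j) K, hK1, hK2]
    simp
  rw [hp, hm, ← Finset.sum_sub_distrib, ← Finset.sum_sub_distrib]
  refine Finset.sum_eq_zero fun j _ => ?_
  have h := hrec j
  split_ifs at h ⊢ with hj
  · linear_combination Z j * h
  · linear_combination Z j * h

/-- **(E) Existence / identification: the Hogervorst–Rychkov array solves the coefficient Casimir
system** (`a = b = 0`) strictly above the 3D unitarity bound — for EVERY such `Δ`, accidental
degeneracies included (there the HR solution is one of several). Assembly of Identity I (weights
`A, B` act on `e_{N,j}` as the scalar `c_{Δ+N-ℓ,j} - c_{Δ,ℓ}`), Identity II (weights `C, D, E` map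
`e_{N,j}` to `-(γ⁺/2) e_{N+1,j+1} - (γ⁻/2) e_{N+1,j-1}`) and the recursion (3.9) termwise
(`hrCoeff_succ_rec_all`). [cite: HogervorstRychkov2013, §3 eqs. (3.6)–(3.9)] -/
theorem hrMonomialCoeff_satisfies {Δ : ℝ} {ℓ : ℕ} (hΔ : unitarityBound3D ℓ < Δ) :
    SatisfiesCoeffCasimir 0 0 Δ ℓ (hrMonomialCoeff Δ ℓ) := by
  intro P Q
  rw [coeffCasimirLHS_eq_add]
  have hLAB0 : coeffLAB Δ ℓ (fun _ => (0 : ℝ)) P Q = 0 := by simp [coeffLAB]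
  have hLCDE0 : coeffLCDE 0 0 Δ ℓ (fun _ => (0 : ℝ)) P Q = 0 := by simp [coeffLCDE]
  rcases Nat.lt_or_ge (P + Q) (ℓ + 1) with hM | hM
  · -- every entry referenced has degree `< ℓ`
    rw [coeffLAB_congr Δ ℓ (k' := fun _ => (0 : ℝ))
        (fun hP => hrMonomialCoeff_eq_zero_of_lt Δ ℓ (by show P - 1 + Q < ℓ; omega))
        (fun hQ => hrMonomialCoeff_eq_zero_of_lt Δ ℓ (by show P + (Q - 1) < ℓ; omega)),
      coeffLCDE_congr 0 0 Δ ℓ (k' := fun _ => (0 : ℝ))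
        (fun hP => hrMonomialCoeff_eq_zero_of_lt Δ ℓ (by show P - 2 + Q < ℓ; omega))
        (fun hP hQ => hrMonomialCoeff_eq_zero_of_lt Δ ℓ (by show P - 1 + (Q - 1) < ℓ; omega))
        (fun hQ => hrMonomialCoeff_eq_zero_of_lt Δ ℓ (by show P + (Q - 2) < ℓ; omega)),
      hLAB0, hLCDE0, add_zero]
  by_cases hM1 : P + Q = ℓ + 1
  · -- output degree `ℓ + 1`: sources of degree `ℓ` (only `j = ℓ`, zero Casimir shift) and `ℓ - 1` (none)
    rw [coeffLAB_congr Δ ℓ (k' := hrSlice Δ ℓ ℓ)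
        (fun hP => hrMonomialCoeff_eq_slice Δ ℓ (by show P - 1 + Q = ℓ; omega) le_rfl)
        (fun hQ => hrMonomialCoeff_eq_slice Δ ℓ (by show P + (Q - 1) = ℓ; omega) le_rfl),
      coeffLCDE_congr 0 0 Δ ℓ (k' := fun _ => (0 : ℝ))
        (fun hP => hrMonomialCoeff_eq_zero_of_lt Δ ℓ (by show P - 2 + Q < ℓ; omega))
        (fun hP hQ => hrMonomialCoeff_eq_zero_of_lt Δ ℓ (by show P - 1 + (Q - 1) < ℓ; omega))
        (fun hQ => hrMonomialCoeff_eq_zero_of_lt Δ ℓ (by show P + (Q - 2) < ℓ; omega)),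
      hLCDE0, add_zero]
    unfold hrSlice
    rw [coeffLAB_sum]
    refine Finset.sum_eq_zero fun j _ => ?_
    rw [coeffLAB_legendreArrDeg Δ ℓ ℓ j P Q hM1, Nat.sub_self]
    by_cases hjl : j = ℓ
    · subst hjl
      have h0 : casShiftDeg Δ j j j = 0 := by unfold casShiftDeg; simp
      rw [h0, zero_mul, mul_zero]
    · rw [hrCoeff_zero_of_ne Δ hjl, zero_div, zero_mul]
  · -- output degree `ℓ + n₂ + 2`, `n₂ ≥ 0`: sources of degree `N₁ = ℓ + n₂ + 1` and `N₂ = ℓ + n₂`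
    obtain ⟨n₂, hn⟩ : ∃ n₂, P + Q = ℓ + n₂ + 2 := ⟨P + Q - ℓ - 2, by omega⟩
    rw [coeffLAB_congr Δ ℓ (k' := hrSlice Δ ℓ (ℓ + n₂ + 1))
        (fun hP => hrMonomialCoeff_eq_slice Δ ℓ (by show P - 1 + Q = ℓ + n₂ + 1; omega) (by omega))
        (fun hQ => hrMonomialCoeff_eq_slice Δ ℓ (by show P + (Q - 1) = ℓ + n₂ + 1; omega) (by omega)),
      coeffLCDE_congr 0 0 Δ ℓ (k' := hrSlice Δ ℓ (ℓ + n₂))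
        (fun hP => hrMonomialCoeff_eq_slice Δ ℓ (by show P - 2 + Q = ℓ + n₂; omega) (by omega))
        (fun hP hQ => hrMonomialCoeff_eq_slice Δ ℓ (by show P - 1 + (Q - 1) = ℓ + n₂; omega)
          (by omega))
        (fun hQ => hrMonomialCoeff_eq_slice Δ ℓ (by show P + (Q - 2) = ℓ + n₂; omega) (by omega))]
    unfold hrSlice
    rw [coeffLAB_sum, coeffLCDE_sum]
    have hi1 : ℓ + n₂ + 1 - ℓ = n₂ + 1 := by omega
    have hi2 : ℓ + n₂ - ℓ = n₂ := by omega
    have hE : Δ + ((ℓ + n₂ : ℕ) : ℝ) - ℓ = Δ + (n₂ : ℝ) := by push_cast; ring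
    rw [hi1, hi2]
    have e1 : ∀ j ∈ range (ℓ + n₂ + 1 + 1),
        hrCoeff Δ ℓ (n₂ + 1) j / legendreLam ℓ * coeffLAB Δ ℓ (legendreArrDeg (ℓ + n₂ + 1) j) P Q =
          1 / (2 * legendreLam ℓ) * (casimirPivot3D Δ ℓ (n₂ + 1) j * hrCoeff Δ ℓ (n₂ + 1) j *
            zdiff (legendreArrDeg (ℓ + n₂ + 1) j) P Q) := by
      intro j _
      rw [coeffLAB_legendreArrDeg Δ ℓ (ℓ + n₂ + 1) j P Q (by omega),
        ← two_mul_casShiftDeg Δ ℓ (n₂ + 1) j, show ℓ + (n₂ + 1) = ℓ + n₂ + 1 by ring]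
      field_simp
    have e2 : ∀ j ∈ range (ℓ + n₂ + 1),
        hrCoeff Δ ℓ n₂ j / legendreLam ℓ * coeffLCDE 0 0 Δ ℓ (legendreArrDeg (ℓ + n₂) j) P Q =
          1 / (2 * legendreLam ℓ) *
            (-(hrGammaPlus (Δ + n₂) j * hrCoeff Δ ℓ n₂ j *
                zdiff (legendreArrDeg (ℓ + n₂ + 1) (j + 1)) P Q) -
              hrGammaMinus (Δ + n₂) j * hrCoeff Δ ℓ n₂ j *
                zdiff (legendreArrDeg (ℓ + n₂ + 1) (j - 1)) P Q) := by
      intro j hj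
      have hj' := mem_range.mp hj
      rw [coeffLCDE_legendreArrDeg Δ ℓ (ℓ + n₂) j P Q (by omega) (by omega), hE]
      field_simp
    rw [Finset.sum_congr rfl e1, Finset.sum_congr rfl e2, ← Finset.mul_sum, ← Finset.mul_sum,
      ← mul_add, Finset.sum_sub_distrib, Finset.sum_neg_distrib]
    have key := sum_recursion_cancel (ℓ + n₂) (fun j => hrCoeff Δ ℓ (n₂ + 1) j)
      (fun j => hrCoeff Δ ℓ n₂ j) (fun j => casimirPivot3D Δ ℓ (n₂ + 1) j)
      (fun j => hrGammaPlus (Δ + n₂) j) (fun j => hrGammaMinus (Δ + n₂) j)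
      (fun j => zdiff (legendreArrDeg (ℓ + n₂ + 1) j) P Q)
      (fun j => hrCoeff_succ_rec_all hΔ n₂ j) (hrGammaMinus_zero _)
      (hrCoeff_eq_zero_of_lt Δ (by omega)) (hrCoeff_eq_zero_of_lt Δ (by omega))
    rw [show ℓ + n₂ + 2 = ℓ + n₂ + 1 + 1 by ring] at key
    linear_combination (1 / (2 * legendreLam ℓ)) * key

/-! ### Consequences via uniqueness -/

/-- **The block coefficients ARE the Hogervorst–Rychkov coefficients.** Strictly above the
unitarity bound and off the accidental-degeneracy set, any symmetric solution of the `a = b = 0`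
coefficient Casimir system with the Dolan–Osborn boundary condition equals `hrMonomialCoeff Δ ℓ`
(uniqueness `SatisfiesCoeffCasimir.unique` + existence `hrMonomialCoeff_satisfies`).
[cite: HogervorstRychkov2013, §3 eqs. (3.4)–(3.9)] -/
theorem SatisfiesCoeffCasimir.eq_hrMonomialCoeff {Δ : ℝ} {ℓ : ℕ} {k : ℕ × ℕ → ℝ}
    (hΔ : unitarityBound3D ℓ < Δ) (hreg : ¬ accidentalDegeneracy3D Δ ℓ)
    (hk : SatisfiesCoeffCasimir 0 0 Δ ℓ k) (hks : ∀ p : ℕ × ℕ, k (p.2, p.1) = k p)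
    (hkl : HasLeadingPart ℓ k) : k = hrMonomialCoeff Δ ℓ :=
  hk.unique hΔ hreg (hrMonomialCoeff_satisfies hΔ) hks (hrMonomialCoeff_symm Δ ℓ) hkl
    (hrMonomialCoeff_hasLeadingPart Δ ℓ)

/-- Corollary: at such `(Δ, ℓ)` every coefficient `k_{mn}` of a solution is non-negative.
[cite: HogervorstRychkov2013, §3 after eq. (3.9)] -/
theorem SatisfiesCoeffCasimir.nonneg {Δ : ℝ} {ℓ : ℕ} {k : ℕ × ℕ → ℝ}
    (hΔ : unitarityBound3D ℓ < Δ) (hreg : ¬ accidentalDegeneracy3D Δ ℓ)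
    (hk : SatisfiesCoeffCasimir 0 0 Δ ℓ k) (hks : ∀ p : ℕ × ℕ, k (p.2, p.1) = k p)
    (hkl : HasLeadingPart ℓ k) (p : ℕ × ℕ) : 0 ≤ k p := by
  rw [hk.eq_hrMonomialCoeff hΔ hreg hks hkl]
  exact hrMonomialCoeff_nonneg hΔ p

/-- Corollary: at such `(Δ, ℓ)` the diagonal coefficients of a solution are the HR level sums,
`d_{ℓ+n} = hrLevelSum Δ ℓ n / λ_ℓ` (`≥ 0`, `d_ℓ = 1/λ_ℓ`), and `d_N = 0` for `N < ℓ`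
(`diagCoeff_eq_zero_of_lt`): so `g(x,x) = λ_ℓ⁻¹ Σ_n a_n(Δ,ℓ) x^{Δ+n}` coefficientwise — the input
of the diagonal enclosure `DiagonalSeriesEnclosure`. [cite: HogervorstRychkov2013, §3 eq. (3.4)] -/
theorem SatisfiesCoeffCasimir.diagCoeff_eq {Δ : ℝ} {ℓ : ℕ} {k : ℕ × ℕ → ℝ}
    (hΔ : unitarityBound3D ℓ < Δ) (hreg : ¬ accidentalDegeneracy3D Δ ℓ)
    (hk : SatisfiesCoeffCasimir 0 0 Δ ℓ k) (hks : ∀ p : ℕ × ℕ, k (p.2, p.1) = k p)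
    (hkl : HasLeadingPart ℓ k) (n : ℕ) :
    diagCoeff k (ℓ + n) = hrLevelSum Δ ℓ n / legendreLam ℓ := by
  rw [hk.eq_hrMonomialCoeff hΔ hreg hks hkl]
  exact diagCoeff_hrMonomialCoeff Δ ℓ n

/-- The diagonal coefficients of a solution are non-negative. [cite: HogervorstRychkov2013, §3 after eq. (3.9)] -/
theorem SatisfiesCoeffCasimir.diagCoeff_nonneg {Δ : ℝ} {ℓ : ℕ} {k : ℕ × ℕ → ℝ}
    (hΔ : unitarityBound3D ℓ < Δ) (hreg : ¬ accidentalDegeneracy3D Δ ℓ)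
    (hk : SatisfiesCoeffCasimir 0 0 Δ ℓ k) (hks : ∀ p : ℕ × ℕ, k (p.2, p.1) = k p)
    (hkl : HasLeadingPart ℓ k) (N : ℕ) : 0 ≤ diagCoeff k N := by
  rw [hk.eq_hrMonomialCoeff hΔ hreg hks hkl]
  exact Finset.sum_nonneg fun p _ => hrMonomialCoeff_nonneg hΔ p

end Literature.MathematicalPhysics.QuantumFieldTheory.ConformalBootstrap3D
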